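import Summits.Parity.GeneralizedHardyLittlewood.Theorems.FordMaynardSieveConst01651SieveConst01651CertReduction
import HarnessLib

/-!
# Route `FordMaynardSieveConst01651`, target `SieveConst01651` (stmt-Parity-19185), stub `stub_coneCertClosed`,
# conjunct (iv) in dimension 4 — by complement pairing, no type enumeration

Def-free helper file.  The certifier checks `55 225` open types in dimension `4`; this file shows they are unnecessary:
for cone data `g₀` with `g₀(∅) = 1`, the closed support clause at `ν ≥ 1/8`, `g₁ ≤ −1` on `(ν, 1/2]`,
`0 ≤ G`, `g₂ ≤ G ≤ 1` on pairs with `|y| < 1/2`, `g₂ ≤ 0` on pairs with `|y| = 1/2` and on pairs inside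
`(ν, 1/2 − 2ν)²`, `g₃ ≤ p ≤ 2` (`|y| < 1/2`), `g₃ ≤ 0` (`|y| = 1/2`), every monotone `x ∈ ℝ⁴` with `xᵢ > ν`, `|x| = 1`
has `(𝟙⋆g₀)(x) ≤ 0` (`starSum_four_nonpos`):

* if `x₄ ≤ 1/2`: the four singletons give `−4`, no triple has sum `< 1/2` (its complement is a single coordinate
  `≤ 1/2`), and the `6` pairs split into `3` complementary couples `{A, Aᶜ}` with `|x_A| + |x_{Aᶜ}| = 1`, each couple
  contributing `≤ G`; total `≤ 1 − 4 + 3G ≤ 0`;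
* if `x₄ > 1/2`: `x₁ + x₂ + x₃ < 1/2`, so the three small coordinates lie in `(ν, 1/2 − 2ν)`: singletons `−3`, the three
  small pairs `≤ 0`, pairs with `x₄` vanish, the small triple `≤ p`, the others vanish; total `≤ 1 − 3 + p ≤ 0`.

For the witness `coneCert` (`G = 1`, `p = 0.941613`, corner pairs `≤ −0.307737 ≤ 0` since `1/2 − 2ν₀ ≤ 1 − 5ν₀`):
`coneCert_signClause_four`, hence `coneCert_signClause_of_five` (conjunct (iv) ⟸ its dimension-5 instance ALONE) and
`stub_coneCertClosed_of_residues'` — the registered stub signature ⟸ `h5 ∧ hV`.  The residual type check is now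
dimension `5` only (`86 966` open types, `1 104` of them violated-but-empty).

References: [FordMaynard2024PrimeSieves] arXiv:2407.14368, Theorem 7.3 (a), §8.2.
-/

noncomputable section

open Finset
open scoped Classical
open Literature.NumberTheory.Sieve Literature.NumberTheory.Sieve.FordMaynard

namespace Summit.Parity.GeneralizedHardyLittlewood.FordMaynardSieveConst01651SieveConst01651

/-- **`k = 4`** of the sign clause from table facts (see the module docstring for the argument).
[cite: FordMaynard2024PrimeSieves, Theorem 7.3 (a) (sign hypothesis on ℋ), §8.2] -/
theorem starSum_four_nonpos {ν G p : ℝ} {g₀ : VecFn}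
    (hsupp : ∀ (r : ℕ) (y : Fin r → ℝ), Monotone y → g₀ r y ≠ 0 → r = 0 ∨ ((∀ i, ν < y i) ∧ ∑ i, y i ≤ 1 / 2))
    (h0 : ∀ e : Fin 0 → ℝ, g₀ 0 e = 1)
    (hg1 : ∀ y : Fin 1 → ℝ, ν < y 0 → y 0 ≤ 1 / 2 → g₀ 1 y ≤ -1)
    (hν : 1 / 8 ≤ ν)
    (hG : ∀ y : Fin 2 → ℝ, Monotone y → (∀ i, ν < y i) → ∑ i, y i < 1 / 2 → g₀ 2 y ≤ G)
    (hG0 : 0 ≤ G) (hG1 : G ≤ 1)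
    (hGhalf : ∀ y : Fin 2 → ℝ, Monotone y → (∀ i, ν < y i) → ∑ i, y i = 1 / 2 → g₀ 2 y ≤ 0)
    (hneg : ∀ y : Fin 2 → ℝ, Monotone y → (∀ i, ν < y i) → (∀ i, y i < 1 / 2 - 2 * ν) → g₀ 2 y ≤ 0)
    (hp3 : ∀ y : Fin 3 → ℝ, Monotone y → (∀ i, ν < y i) → ∑ i, y i < 1 / 2 → g₀ 3 y ≤ p) (hp2 : p ≤ 2)
    (hp3' : ∀ y : Fin 3 → ℝ, Monotone y → (∀ i, ν < y i) → ∑ i, y i = 1 / 2 → g₀ 3 y ≤ 0)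
    {x : Fin 4 → ℝ} (hx : Monotone x) (hbox : ∀ i, ν < x i) (hsum : ∑ i, x i = 1) :
    starSum g₀ 4 x ≤ 0 := by
  have hν0 : 0 < ν := by linarith
  have hpos : ∀ i, 0 < x i := fun i => hν0.trans (hbox i)
  have h0123 : x 0 + x 1 + x 2 + x 3 = 1 := by
    rw [Fin.sum_univ_four] at hsum; exact hsum
  have h01 : x 0 ≤ x 1 := hx (by decide)
  have h12 : x 1 ≤ x 2 := hx (by decide)
  have h23 : x 2 ≤ x 3 := hx (by decide)
  have hx2 : x 2 < 1 / 2 := by linarith [hpos 0, hpos 1]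
  set term : Finset (Fin 4) → ℝ := fun A => g₀ A.card (fun i => x (A.orderEmbOfFin rfl i)) with hterm_def
  -- generic facts about the terms
  have hterm0 : ∀ A : Finset (Fin 4), A.card = 0 → term A = 1 := by
    intro A hA; simp only [hterm_def]; rw [← apply_orderEmb_cast' g₀ x A hA, h0]
  have hterm1 : ∀ A : Finset (Fin 4), A.card = 1 → term A ≤ 0 ∧ (∑ i ∈ A, x i ≤ 1 / 2 → term A ≤ -1) := by
    intro A hA
    have hle := apply_single_le hsupp hg1 hx hbox A hA
    have htA : term A = g₀ 1 (fun i => x (A.orderEmbOfFin hA i)) := by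
      simp only [hterm_def]; rw [← apply_orderEmb_cast' g₀ x A hA]
    rw [htA]
    refine ⟨hle.trans (by split_ifs <;> norm_num), fun hs => ?_⟩
    rw [if_pos hs] at hle; exact hle
  have hterm_half : ∀ A : Finset (Fin 4), ∀ n, ∀ hA : A.card = n, n ≠ 0 → 1 / 2 < ∑ i ∈ A, x i → term A = 0 := by
    intro A n hA hn hs
    simp only [hterm_def]; rw [← apply_orderEmb_cast' g₀ x A hA]
    exact apply_subvector_eq_zero_of_half_lt hsupp hx A hA hn hs
  have hterm4 : ∀ A : Finset (Fin 4), 4 ≤ A.card → term A = 0 := by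
    intro A hA
    simp only [hterm_def]
    refine apply_subvector_eq_zero_of_card hsupp hx hbox A ?_
    have : (4 : ℝ) ≤ A.card := by exact_mod_cast hA
    nlinarith
  -- pair terms: `≤ G` if `|x_A| < 1/2`, `≤ 0` if `= 1/2`, `0` if `> 1/2`
  have hterm2 : ∀ A : Finset (Fin 4), ∀ hA : A.card = 2,
      (∑ i ∈ A, x i < 1 / 2 → term A ≤ G) ∧ (∑ i ∈ A, x i = 1 / 2 → term A ≤ 0) := by
    intro A hA
    have htA : term A = g₀ 2 (fun i => x (A.orderEmbOfFin hA i)) := by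
      simp only [hterm_def]; rw [← apply_orderEmb_cast' g₀ x A hA]
    have hm : Monotone (fun i => x (A.orderEmbOfFin hA i)) := hx.comp (A.orderEmbOfFin hA).monotone
    have hs := sum_orderEmb_eq x A hA
    rw [htA]
    exact ⟨fun h => hG _ hm (fun i => hbox _) (by rw [hs]; exact h),
      fun h => hGhalf _ hm (fun i => hbox _) (by rw [hs]; exact h)⟩
  have hterm3 : ∀ A : Finset (Fin 4), ∀ hA : A.card = 3,
      (∑ i ∈ A, x i < 1 / 2 → term A ≤ p) ∧ (∑ i ∈ A, x i = 1 / 2 → term A ≤ 0) := by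
    intro A hA
    have htA : term A = g₀ 3 (fun i => x (A.orderEmbOfFin hA i)) := by
      simp only [hterm_def]; rw [← apply_orderEmb_cast' g₀ x A hA]
    have hm : Monotone (fun i => x (A.orderEmbOfFin hA i)) := hx.comp (A.orderEmbOfFin hA).monotone
    have hs := sum_orderEmb_eq x A hA
    rw [htA]
    exact ⟨fun h => hp3 _ hm (fun i => hbox _) (by rw [hs]; exact h),
      fun h => hp3' _ hm (fun i => hbox _) (by rw [hs]; exact h)⟩
  by_cases hx3 : x 3 ≤ 1 / 2
  · /- Case `x₄ ≤ 1/2`: bound `term A ≤ c |A| + [|A| = 2] term A`, `c 0 = 1`, `c 1 = -1`, else `0`;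
       the pairs are paired with their complements. -/
    have hhalf : ∀ i, x i ≤ 1 / 2 := by
      intro i; fin_cases i <;> simp <;> linarith
    set c : ℕ → ℝ := fun r => if r = 0 then 1 else if r = 1 then -1 else 0 with hc
    have hbound : ∀ A : Finset (Fin 4), term A ≤ c A.card + (if A.card = 2 then term A else 0) := by
      intro A
      by_cases hA0 : A.card = 0
      · rw [hterm0 A hA0, hA0]; simp [hc]
      by_cases hA1 : A.card = 1
      · obtain ⟨a, rfl⟩ := Finset.card_eq_one.1 hA1
        have := (hterm1 {a} hA1).2 (by rw [Finset.sum_singleton]; exact hhalf a)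
        rw [hA1]; simp [hc]; linarith
      by_cases hA2 : A.card = 2
      · rw [if_pos hA2, hA2]; simp [hc]
      by_cases hA3 : A.card = 3
      · -- the complement is a singleton `{m}` with `x m ≤ 1/2`, so `|x_A| = 1 - x m ≥ 1/2`
        have hsA : 1 / 2 ≤ ∑ i ∈ A, x i := by
          have hc1 : Aᶜ.card = 1 := by rw [Finset.card_compl, Fintype.card_fin, hA3]
          obtain ⟨m, hm⟩ := Finset.card_eq_one.1 hc1
          have hsplit := Finset.sum_add_sum_compl A x
          rw [hm, Finset.sum_singleton, hsum] at hsplit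
          linarith [hhalf m]
        have : term A ≤ 0 := by
          rcases hsA.lt_or_eq with h | h
          · rw [hterm_half A 3 hA3 (by norm_num) h]
          · exact (hterm3 A hA3).2 h.symm
        rw [if_neg (by omega), hA3]; simp [hc]; linarith
      · have h4 : 4 ≤ A.card := by omega
        rw [hterm4 A h4, if_neg (by omega)]
        have : c A.card = 0 := by simp only [hc]; rw [if_neg hA0, if_neg hA1]
        rw [this]; norm_num
    have hconst : ∑ A : Finset (Fin 4), c A.card = 1 - 4 := by
      rw [← Finset.powerset_univ, Finset.sum_powerset_apply_card]
      simp [hc, Finset.sum_range_succ, Nat.choose, Finset.card_univ, Fintype.card_fin]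
      norm_num
    -- pairs, paired with complements
    set S : Finset (Finset (Fin 4)) := Finset.univ.filter (fun A => A.card = 2) with hS
    have hmemS : ∀ {A : Finset (Fin 4)}, A ∈ S ↔ A.card = 2 := by intro A; simp [hS]
    have hcomplS : ∀ A ∈ S, Aᶜ ∈ S := by
      intro A hA; rw [hmemS] at hA ⊢; rw [Finset.card_compl, Fintype.card_fin, hA]
    have hswap : ∑ A ∈ S, term Aᶜ = ∑ A ∈ S, term A :=
      Finset.sum_nbij' (fun A => Aᶜ) (fun A => Aᶜ) hcomplS hcomplS (fun A _ => compl_compl A)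
        (fun A _ => compl_compl A) (fun A _ => rfl)
    have hpair : ∀ A ∈ S, term A + term Aᶜ ≤ G := by
      intro A hA
      have h2 : A.card = 2 := hmemS.1 hA
      have h2c : Aᶜ.card = 2 := hmemS.1 (hcomplS A hA)
      have hsc : ∑ i ∈ A, x i + ∑ i ∈ Aᶜ, x i = 1 := by rw [Finset.sum_add_sum_compl, hsum]
      rcases lt_trichotomy (∑ i ∈ A, x i) (1 / 2) with hlt' | heq | hgt
      · have e1 := (hterm2 A h2).1 hlt'
        have e2 := hterm_half Aᶜ 2 h2c two_ne_zero (by linarith)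
        linarith
      · have e1 := (hterm2 A h2).2 heq
        have e2 := (hterm2 Aᶜ h2c).2 (by linarith)
        linarith
      · have e1 := hterm_half A 2 h2 two_ne_zero hgt
        have e2 := (hterm2 Aᶜ h2c).1 (by linarith)
        linarith
    have hScard : S.card = 6 := by
      have : S = Finset.powersetCard 2 (Finset.univ : Finset (Fin 4)) := by
        rw [Finset.powersetCard_eq_filter, Finset.powerset_univ]
      rw [this, Finset.card_powersetCard, Finset.card_univ, Fintype.card_fin]; decide
    have hpairs : ∑ A ∈ S, term A ≤ 3 * G := by
      have h2 : 2 * ∑ A ∈ S, term A = ∑ A ∈ S, (term A + term Aᶜ) := by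
        rw [Finset.sum_add_distrib, hswap]; ring
      have h3 : ∑ A ∈ S, (term A + term Aᶜ) ≤ ∑ _A ∈ S, G := Finset.sum_le_sum hpair
      rw [Finset.sum_const, hScard, nsmul_eq_mul] at h3
      push_cast at h3
      linarith
    calc starSum g₀ 4 x = ∑ A : Finset (Fin 4), term A := rfl
      _ ≤ ∑ A : Finset (Fin 4), (c A.card + (if A.card = 2 then term A else 0)) :=
          Finset.sum_le_sum fun A _ => hbound A
      _ = (∑ A : Finset (Fin 4), c A.card) + ∑ A ∈ S, term A := by
          rw [Finset.sum_add_distrib, Finset.sum_filter]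
      _ ≤ (1 - 4) + 3 * G := by rw [hconst]; linarith
      _ ≤ 0 := by linarith
  · /- Case `x₄ > 1/2`: the small coordinates lie in `(ν, 1/2 - 2ν)`; bound
       `term A ≤ c |A| + [A = {3}] + [A = {0,1,2}]·p`. -/
    push Not at hx3
    have hsmall : ∀ i : Fin 4, i ≠ 3 → x i < 1 / 2 - 2 * ν := by
      intro i hi
      have hb0 := hbox 0; have hb1 := hbox 1; have hb2 := hbox 2
      fin_cases i <;> simp at hi ⊢ <;> linarith
    set c : ℕ → ℝ := fun r => if r = 0 then 1 else if r = 1 then -1 else 0 with hc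
    set b : Finset (Fin 4) → ℝ := fun A =>
      c A.card + (if A = {3} then 1 else 0) + (if A = {0, 1, 2} then p else 0) with hb
    have hp0 : 0 ≤ p ∨ p < 0 := le_or_gt 0 p
    -- a set of size ≥ 2 containing `3` has sum `> 1/2`
    have hbig : ∀ A : Finset (Fin 4), (3 : Fin 4) ∈ A → 2 ≤ A.card → 1 / 2 < ∑ i ∈ A, x i := by
      intro A h3 hcard
      rw [← Finset.add_sum_erase A x h3]
      have hne : (A.erase 3).Nonempty := by
        rw [← Finset.card_pos, Finset.card_erase_of_mem h3]; omega
      have : 0 < ∑ i ∈ A.erase 3, x i := Finset.sum_pos (fun i _ => hpos i) hne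
      linarith
    have hbound : ∀ A : Finset (Fin 4), term A ≤ b A := by
      intro A
      simp only [hb]
      have hb1 : 0 ≤ (if A = {3} then (1 : ℝ) else 0) := by split_ifs <;> norm_num
      by_cases hA0 : A.card = 0
      · rw [hterm0 A hA0, hA0]
        have hA' : A ≠ {0, 1, 2} := by intro h; rw [h] at hA0; simp at hA0
        rw [if_neg hA']; simp [hc]; linarith
      by_cases hA1 : A.card = 1
      · obtain ⟨a, rfl⟩ := Finset.card_eq_one.1 hA1
        have hA' : ({a} : Finset (Fin 4)) ≠ {0, 1, 2} := by
          intro h; have := congrArg Finset.card h; simp at this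
        rw [if_neg hA', hA1]
        have hc1 : c 1 = -1 := by simp [hc]
        rw [hc1]
        by_cases ha3 : a = 3
        · subst ha3; rw [if_pos rfl]; linarith [(hterm1 {3} hA1).1]
        · have := (hterm1 {a} hA1).2 (by rw [Finset.sum_singleton]; linarith [hsmall a ha3, hν0])
          linarith
      by_cases hA2 : A.card = 2
      · have hA' : A ≠ {0, 1, 2} := by intro h; rw [h] at hA2; simp at hA2
        have hA'' : A ≠ {3} := by intro h; rw [h] at hA2; simp at hA2
        rw [if_neg hA', if_neg hA'', hA2]
        have hc2 : c 2 = 0 := by simp [hc]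
        rw [hc2]
        by_cases h3 : (3 : Fin 4) ∈ A
        · rw [hterm_half A 2 hA2 two_ne_zero (hbig A h3 (by omega))]; norm_num
        · -- both coordinates are small
          have htA : term A = g₀ 2 (fun i => x (A.orderEmbOfFin hA2 i)) := by
            simp only [hterm_def]; rw [← apply_orderEmb_cast' g₀ x A hA2]
          have hle : g₀ 2 (fun i => x (A.orderEmbOfFin hA2 i)) ≤ 0 :=
            hneg _ (hx.comp (A.orderEmbOfFin hA2).monotone) (fun i => hbox _)
              (fun i => hsmall _ (fun h => h3 (h ▸ A.orderEmbOfFin_mem hA2 i)))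
          rw [htA]; linarith
      by_cases hA3 : A.card = 3
      · have hA'' : A ≠ {3} := by intro h; rw [h] at hA3; simp at hA3
        rw [if_neg hA'', hA3]
        have hc3 : c 3 = 0 := by simp [hc]
        rw [hc3]
        by_cases h3 : (3 : Fin 4) ∈ A
        · have hA' : A ≠ {0, 1, 2} := by intro h; rw [h] at h3; simp at h3
          rw [if_neg hA', hterm_half A 3 hA3 (by norm_num) (hbig A h3 (by omega))]; norm_num
        · have hA' : A = {0, 1, 2} := by
            have key : ∀ B : Finset (Fin 4), B.card = 3 → (3 : Fin 4) ∉ B → B = {0, 1, 2} := by decide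
            exact key A hA3 h3
          rw [if_pos hA']
          have hs : ∑ i ∈ A, x i < 1 / 2 := by
            rw [hA', Finset.sum_insert (by decide), Finset.sum_pair (by decide)]; linarith
          linarith [(hterm3 A hA3).1 hs]
      · have h4 : 4 ≤ A.card := by omega
        have hA' : A ≠ {0, 1, 2} := by intro h; rw [h] at h4; simp at h4
        have hA'' : A ≠ {3} := by intro h; rw [h] at h4; simp at h4
        rw [hterm4 A h4, if_neg hA', if_neg hA'']
        have : c A.card = 0 := by simp only [hc]; rw [if_neg hA0, if_neg hA1]
        rw [this]; norm_num
    have hconst : ∑ A : Finset (Fin 4), c A.card = 1 - 4 := by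
      rw [← Finset.powerset_univ, Finset.sum_powerset_apply_card]
      simp [hc, Finset.sum_range_succ, Nat.choose, Finset.card_univ, Fintype.card_fin]
      norm_num
    have hind1 : ∑ A : Finset (Fin 4), (if A = {3} then (1 : ℝ) else 0) = 1 := by
      rw [Finset.sum_ite_eq']; simp
    have hind2 : ∑ A : Finset (Fin 4), (if A = {0, 1, 2} then p else 0) = p := by
      rw [Finset.sum_ite_eq']; simp
    calc starSum g₀ 4 x = ∑ A : Finset (Fin 4), term A := rfl
      _ ≤ ∑ A : Finset (Fin 4), b A := Finset.sum_le_sum fun A _ => hbound A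
      _ = (∑ A : Finset (Fin 4), c A.card) + (∑ A : Finset (Fin 4), (if A = {3} then (1 : ℝ) else 0)) +
            ∑ A : Finset (Fin 4), (if A = {0, 1, 2} then p else 0) := by
          simp only [hb, Finset.sum_add_distrib]
      _ = (1 - 4) + 1 + p := by rw [hconst, hind1, hind2]
      _ ≤ 0 := by linarith

/-! ### Instantiation for the witness `coneCert` -/

/-- A pair with `y₀ + y₁ = 1/2` carries at most a face penalty: `coneCert₂(y) ≤ 0`. [folklore] -/
theorem coneCert_two_half (y : Fin 2 → ℝ) (h : ∑ i, y i = 1 / 2) : coneCert 2 y ≤ 0 := by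
  show gTab 2 y + gFace 2 y ≤ 0
  have hT : gTab 2 y = 0 := by
    show (if _ then _ else _ : ℝ) = 0
    rw [if_neg (by rintro ⟨-, -, -, -, hlt⟩; rw [Fin.sum_univ_two] at h; linarith)]
  have hF := gFace_nonpos 2 y
  linarith

/-- **The sign clause in dimension `4` for `coneCert`, PROVED** (no type check). [cite: FordMaynard2024PrimeSieves, Theorem 7.3 (a), §8.2] -/
theorem coneCert_signClause_four (x : Fin 4 → ℝ) (hx : Monotone x)
    (hbox : ∀ i, (1651 / 10000 : ℝ) < x i ∧ x i < 1 - 1651 / 10000) (hsum : ∑ i, x i = 1) :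
    starSum coneCert 4 x ≤ 0 := by
  refine starSum_four_nonpos (ν := 1651 / 10000) (G := 1) (p := 941613 / 1000000) coneCert_support coneCert_empty
    (fun y h1 h2 => coneCert_one_le y h1 h2) (by norm_num) (fun y _ _ _ => coneCert_two_le_one y) (by norm_num) le_rfl
    (fun y _ _ h => coneCert_two_half y h) (fun y hy hb hl => ?_) (fun y _ _ _ => coneCert_three_le y) (by norm_num)
    (fun y _ _ h => coneCert_three_half y h) hx (fun i => (hbox i).1) hsum
  have : coneCert 2 y ≤ -(307737 / 1000000) :=
    coneCert_two_corner_le y hy hb (fun i => by have := hl i; linarith)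
  linarith

/-- **Conjunct (iv) of `stub_coneCertClosed` for `coneCert` from its dimension-`5` instance ALONE.**
[cite: FordMaynard2024PrimeSieves, Theorem 7.3 (a), §8.2] -/
theorem coneCert_signClause_of_five
    (h5 : ∀ x : Fin 5 → ℝ, Monotone x → (∀ i, (1651 / 10000 : ℝ) < x i ∧ x i < 1 - 1651 / 10000) →
      ∑ i, x i = 1 → starSum coneCert 5 x ≤ 0) :
    ∀ k : ℕ, 2 ≤ k → k ≤ 6 → ∀ x : Fin k → ℝ, Monotone x →
      (∀ i, (1651 / 10000 : ℝ) < x i ∧ x i < 1 - 1651 / 10000) → ∑ i, x i = 1 → starSum coneCert k x ≤ 0 :=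
  coneCert_signClause_of_four_five coneCert_signClause_four h5

/-- **`stub_coneCertClosed` from TWO residues**: the registered signature of `stub_coneCertClosed`, verbatim, follows
from the dimension-`5` sign check for `coneCert` (the certifier's `86 966` open types) and the positivity of the
certificate value `V(0.1651, coneCert)` (Arb-certified `0.0027065` outside Lean). [cite: FordMaynard2024PrimeSieves, Theorem 7.3 (a), §8.2] -/
theorem stub_coneCertClosed_of_residues'
    (h5 : ∀ x : Fin 5 → ℝ, Monotone x → (∀ i, (1651 / 10000 : ℝ) < x i ∧ x i < 1 - 1651 / 10000) →
      ∑ i, x i = 1 → starSum coneCert 5 x ≤ 0)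
    (hV : 0 < sieveBoundG1 (1651 / 10000) coneCert) :
    ∃ g₀ : VecFn, IsPiecewiseConstOnCone g₀ ∧ (∀ e : Fin 0 → ℝ, g₀ 0 e = 1) ∧
      (∀ (k : ℕ) (x : Fin k → ℝ), Monotone x → g₀ k x ≠ 0 →
        k = 0 ∨ ((∀ i, (1651 / 10000 : ℝ) < x i) ∧ ∑ i, x i ≤ 1 / 2)) ∧
      (∀ k : ℕ, 2 ≤ k → k ≤ 6 → ∀ x : Fin k → ℝ, Monotone x →
        (∀ i, (1651 / 10000 : ℝ) < x i ∧ x i < 1 - 1651 / 10000) → ∑ i, x i = 1 → starSum g₀ k x ≤ 0) ∧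
      0 < sieveBoundG1 (1651 / 10000) g₀ :=
  stub_coneCertClosed_of_residues coneCert_signClause_four h5 hV

end Summit.Parity.GeneralizedHardyLittlewood.FordMaynardSieveConst01651SieveConst01651

end
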